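import Mathlib.Analysis.Calculus.InverseFunctionTheorem.FDeriv
import Mathlib.Analysis.Calculus.ContDiff.Operations
import Mathlib.Analysis.Calculus.ContDiff.RCLike
import Mathlib.Analysis.Calculus.FDeriv.Prod
import Mathlib.Analysis.Calculus.FDeriv.Mul
import Mathlib.Analysis.Calculus.FDeriv.Add
import Mathlib.Analysis.InnerProductSpace.PiL2
import Mathlib.Analysis.Complex.Basic
import Mathlib.Analysis.Normed.Operator.Banach
import Mathlib.Analysis.Normed.Operator.BoundedLinearMaps
import Mathlib.LinearAlgebra.Complex.FiniteDimensional
import Mathlib.LinearAlgebra.FiniteDimensional.Lemmas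
import Mathlib.Tactic.LinearCombination
import Mathlib.Tactic.Module
import Mathlib.Tactic.Linarith

/-!
# Straightening a flat `J`-holomorphic embedded disc

Crux `WitnessCharge` (stmt-SmoothPoincare4-7824), line `Sketch`: registered stub
`helper_straightenFlatDisc`, the geometric step of the reduction of McDuff's intersection
dichotomy for two `J`-holomorphic branches to an analytic atom.

Given the chart expression `g : ℂ → ℝ⁴` of the regular branch — a flat `Jt`-holomorphic disc on
`ball 0 r` with injective differential at `0`, where `Jt` is a smooth field of complex structures
(`Jt y ∘ Jt y = -1`) on a set `T ⊇ g (ball 0 r)` — we produce local coordinates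
`Φ : ℂ × ℂ → ℝ⁴` (an `OpenPartialHomeomorph`, smooth with smooth inverse and invertible
differential on its source) around `g 0` in which the disc is the axis `{w = 0}` and the structure
is standard (multiplication by `i`) at the points of the axis (a McDuff 1991, Lemma 2.5-type
normalisation).

Construction: pick `n₀ ∉ L := range dg₀` (a real `2`-plane in `ℝ⁴`), put
`Φ (z, w) := g z + (Re w) • n₀ + (Im w) • Jt (g z) n₀`; its differential at `(z, 0)` is
`(ζ, η) ↦ dg_z ζ + (Re η) n₀ + (Im η) Jt (g z) n₀`, which intertwines `i` and `Jt (g z)` and is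
injective (hence invertible) at `z = 0`; the inverse function theorem and a restriction to the open
set where the differential is invertible finish the proof.
-/

noncomputable section

set_option linter.dupNamespace false

open scoped ContDiff Topology

namespace Summit.SmoothPoincare4.SmoothPoincare4.Theorems.WitnessCharge.PencilIncompleteness

/-- **Straightening a flat `J`-holomorphic embedded disc.** Let `Jt` be a `C^∞` field of complex
structures on `T ⊆ ℝ⁴` and `g : ball 0 r → T` a `C^∞` `Jt`-holomorphic disc
(`dg_z (i ζ) = Jt (g z) (dg_z ζ)`) with `dg₀` injective. Then there are an open partial
homeomorphism `Φ : ℂ × ℂ → ℝ⁴`, `C^∞` with `C^∞` inverse and bijective differential on its source,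
and `0 < ρ ≤ r` such that the bidisc of radius `ρ` lies in `Φ.source`, `Φ (z, 0) = g z`, and
`dΦ_(z, 0) (i w) = Jt (g z) (dΦ_(z, 0) w)` for `‖z‖ < ρ`. Registered helper of crux
stmt-SmoothPoincare4-7824 (line `Sketch`). -/
theorem helper_straightenFlatDisc :
    ∀ (T : Set (EuclideanSpace ℝ (Fin 4))), IsOpen T →
    ∀ (Jt : EuclideanSpace ℝ (Fin 4) → EuclideanSpace ℝ (Fin 4) →L[ℝ] EuclideanSpace ℝ (Fin 4)),
      ContDiffOn ℝ ∞ Jt T →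
      (∀ y ∈ T, ∀ v : EuclideanSpace ℝ (Fin 4), Jt y (Jt y v) = -v) →
    ∀ (g : ℂ → EuclideanSpace ℝ (Fin 4)) (r : ℝ), 0 < r →
      ContDiffOn ℝ ∞ g (Metric.ball 0 r) → Set.MapsTo g (Metric.ball 0 r) T →
      (∀ z ∈ Metric.ball (0 : ℂ) r, ∀ ζ : ℂ,
        fderiv ℝ g z (Complex.I * ζ) = Jt (g z) (fderiv ℝ g z ζ)) →
      Function.Injective (fderiv ℝ g 0) →
      ∃ (Φ : OpenPartialHomeomorph (ℂ × ℂ) (EuclideanSpace ℝ (Fin 4))) (ρ : ℝ), 0 < ρ ∧ ρ ≤ r ∧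
        (∀ q : ℂ × ℂ, ‖q.1‖ < ρ → ‖q.2‖ < ρ → q ∈ Φ.source) ∧
        (∀ z : ℂ, ‖z‖ < ρ → Φ (z, 0) = g z) ∧
        ContDiffOn ℝ ∞ Φ Φ.source ∧ ContDiffOn ℝ ∞ Φ.symm Φ.target ∧
        (∀ q ∈ Φ.source, Function.Bijective (fderiv ℝ Φ q)) ∧
        (∀ z : ℂ, ‖z‖ < ρ → ∀ w : ℂ × ℂ,
          fderiv ℝ Φ (z, 0) (Complex.I • w) = Jt (g z) (fderiv ℝ Φ (z, 0) w)) := by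
  intro T _ Jt hJt hJ2 g r hr hg hgT hJhol hinj
  have h0r : (0 : ℂ) ∈ Metric.ball (0 : ℂ) r := Metric.mem_ball_self hr
  have hx0T : g 0 ∈ T := hgT h0r
  -- Step 1: a vector `n₀` off the real `2`-plane `L = range dg₀`.
  set L : Submodule ℝ (EuclideanSpace ℝ (Fin 4)) :=
    LinearMap.range (fderiv ℝ g (0 : ℂ) : ℂ →ₗ[ℝ] EuclideanSpace ℝ (Fin 4))
  have hLtop : L ≠ ⊤ := by
    intro htop
    have h2 : Module.finrank ℝ L = 2 :=
      (LinearMap.finrank_range_of_inj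
        (f := (fderiv ℝ g (0 : ℂ) : ℂ →ₗ[ℝ] EuclideanSpace ℝ (Fin 4))) hinj).trans
        Complex.finrank_real_complex
    have h4 : Module.finrank ℝ L = 4 := by
      rw [htop, finrank_top, finrank_euclideanSpace_fin]
    omega
  obtain ⟨n₀, hn₀⟩ : ∃ n₀ : EuclideanSpace ℝ (Fin 4), n₀ ∉ L :=
    not_forall.mp fun h => hLtop (Submodule.eq_top_iff'.mpr h)
  -- Step 2: the map `Φfun (z, w) = g z + (Re w) • n₀ + (Im w) • Jt (g z) n₀`; smoothness on
  -- the open set `U = {‖z‖ < r}`.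
  set Φfun : ℂ × ℂ → EuclideanSpace ℝ (Fin 4) := fun q =>
    g q.1 + q.2.re • n₀ + q.2.im • Jt (g q.1) n₀ with hΦfun_def
  set U : Set (ℂ × ℂ) := Prod.fst ⁻¹' Metric.ball (0 : ℂ) r
  have hUo : IsOpen U := Metric.isOpen_ball.preimage continuous_fst
  have hgU : ContDiffOn ℝ ∞ (fun q : ℂ × ℂ => g q.1) U :=
    hg.comp contDiffOn_fst fun q hq => hq
  have hJgnU : ContDiffOn ℝ ∞ (fun q : ℂ × ℂ => Jt (g q.1) n₀) U :=
    (hJt.comp hgU fun q hq => hgT hq).clm_apply contDiffOn_const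
  have hre : ContDiff ℝ ∞ (fun q : ℂ × ℂ => q.2.re) :=
    (Complex.reCLM.comp (ContinuousLinearMap.snd ℝ ℂ ℂ)).contDiff
  have him : ContDiff ℝ ∞ (fun q : ℂ × ℂ => q.2.im) :=
    (Complex.imCLM.comp (ContinuousLinearMap.snd ℝ ℂ ℂ)).contDiff
  have hΦU : ContDiffOn ℝ ∞ Φfun U :=
    (hgU.add (hre.contDiffOn.fun_smul contDiffOn_const)).add (him.contDiffOn.fun_smul hJgnU)
  -- Step 3: the differential `PhiD z` of `Φfun` at an axis point `(z, 0)`, `‖z‖ < r`.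
  set PhiD : ℂ → (ℂ × ℂ →L[ℝ] EuclideanSpace ℝ (Fin 4)) := fun z =>
    (fderiv ℝ g z).comp (ContinuousLinearMap.fst ℝ ℂ ℂ) +
      (Complex.reCLM.comp (ContinuousLinearMap.snd ℝ ℂ ℂ)).smulRight n₀ +
      (Complex.imCLM.comp (ContinuousLinearMap.snd ℝ ℂ ℂ)).smulRight (Jt (g z) n₀)
  have hPhiD_apply : ∀ (z : ℂ) (w : ℂ × ℂ),
      PhiD z w = fderiv ℝ g z w.1 + w.2.re • n₀ + w.2.im • Jt (g z) n₀ := fun z w => rfl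
  have hderiv : ∀ z ∈ Metric.ball (0 : ℂ) r, HasFDerivAt Φfun (PhiD z) (z, 0) := by
    intro z hz
    have hzU : (z, (0 : ℂ)) ∈ U := hz
    have hgz : HasFDerivAt g (fderiv ℝ g z) z :=
      ((hg.contDiffAt (Metric.isOpen_ball.mem_nhds hz)).differentiableAt (by simp)).hasFDerivAt
    have h1 : HasFDerivAt (fun q : ℂ × ℂ => g q.1)
        ((fderiv ℝ g z).comp (ContinuousLinearMap.fst ℝ ℂ ℂ)) (z, 0) :=
      HasFDerivAt.comp ((z, 0) : ℂ × ℂ) hgz hasFDerivAt_fst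
    have h2 : HasFDerivAt (fun q : ℂ × ℂ => q.2.re • n₀)
        ((Complex.reCLM.comp (ContinuousLinearMap.snd ℝ ℂ ℂ)).smulRight n₀) (z, 0) :=
      (Complex.reCLM.comp (ContinuousLinearMap.snd ℝ ℂ ℂ)).hasFDerivAt.smul_const n₀
    have hF3 : HasFDerivAt (fun q : ℂ × ℂ => Jt (g q.1) n₀)
        (fderiv ℝ (fun q : ℂ × ℂ => Jt (g q.1) n₀) (z, 0)) (z, 0) :=
      ((hJgnU.contDiffAt (hUo.mem_nhds hzU)).differentiableAt (by simp)).hasFDerivAt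
    have h3 : HasFDerivAt (fun q : ℂ × ℂ => q.2.im • Jt (g q.1) n₀)
        ((Complex.imCLM.comp (ContinuousLinearMap.snd ℝ ℂ ℂ)).smulRight (Jt (g z) n₀))
        (z, 0) := by
      refine ((Complex.imCLM.comp (ContinuousLinearMap.snd ℝ ℂ ℂ)).hasFDerivAt.fun_smul
        hF3).congr_fderiv ?_
      simp
    exact (h1.fun_add h2).fun_add h3
  -- Step 4: on the axis, `PhiD z` intertwines multiplication by `i` with `Jt (g z)`.
  have hJad : ∀ z ∈ Metric.ball (0 : ℂ) r, ∀ w : ℂ × ℂ,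
      PhiD z (Complex.I • w) = Jt (g z) (PhiD z w) := by
    intro z hz w
    rw [hPhiD_apply, hPhiD_apply, Prod.smul_fst, Prod.smul_snd, smul_eq_mul, smul_eq_mul,
      hJhol z hz, map_add, map_add, map_smul, map_smul, hJ2 _ (hgT hz)]
    simp only [Complex.mul_re, Complex.mul_im, Complex.I_re, Complex.I_im, zero_mul, one_mul,
      zero_sub, zero_add, neg_smul, smul_neg]
    abel
  -- Step 5: `PhiD 0` is injective, hence (equal dimensions `4 = 4`) a linear isomorphism.
  have hd0 : HasFDerivAt Φfun (PhiD 0) (0, 0) := hderiv 0 h0r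
  have hAinj : Function.Injective (PhiD 0) := by
    refine (injective_iff_map_eq_zero (PhiD 0)).mpr ?_
    rintro ⟨ζ, η⟩ hw
    have e1 : fderiv ℝ g 0 ζ + η.re • n₀ + η.im • Jt (g 0) n₀ = 0 := by
      simpa only [hPhiD_apply] using hw
    have e2 : fderiv ℝ g 0 (Complex.I * ζ) + η.re • Jt (g 0) n₀ - η.im • n₀ = 0 := by
      have h := congrArg (Jt (g 0)) e1
      rw [map_zero, map_add, map_add, map_smul, map_smul, hJ2 _ hx0T, ← hJhol 0 h0r, smul_neg,
        ← sub_eq_add_neg] at h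
      exact h
    have key : (η.re ^ 2 + η.im ^ 2) • n₀ =
        fderiv ℝ g 0 (η.im • (Complex.I * ζ) - η.re • ζ) := by
      rw [map_sub, map_smul, map_smul]
      linear_combination (norm := module) η.re • e1 - η.im • e2
    have hsq : η.re ^ 2 + η.im ^ 2 = 0 := by
      by_contra hne
      apply hn₀
      rw [← L.smul_mem_iff hne, key]
      exact LinearMap.mem_range_self _ _
    have hre0 : η.re = 0 := by nlinarith [sq_nonneg η.re, sq_nonneg η.im]
    have him0 : η.im = 0 := by nlinarith [sq_nonneg η.re, sq_nonneg η.im]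
    have hζ : ζ = 0 := by
      apply hinj
      rw [map_zero]
      simpa [hre0, him0] using e1
    have hη : η = 0 := Complex.ext (by simpa using hre0) (by simpa using him0)
    rw [hζ, hη]
    rfl
  have hfin : Module.finrank ℝ (ℂ × ℂ) = Module.finrank ℝ (EuclideanSpace ℝ (Fin 4)) := by
    simp [Module.finrank_prod, Complex.finrank_real_complex]
  have hAsurj : Function.Surjective (PhiD 0) :=
    (LinearMap.injective_iff_surjective_of_finrank_eq_finrank
      (f := ((PhiD 0 : ℂ × ℂ →L[ℝ] EuclideanSpace ℝ (Fin 4)) :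
        ℂ × ℂ →ₗ[ℝ] EuclideanSpace ℝ (Fin 4))) hfin).mp hAinj
  obtain ⟨Aeq, hAeq⟩ : ∃ Aeq : (ℂ × ℂ) ≃L[ℝ] EuclideanSpace ℝ (Fin 4),
      (Aeq : ℂ × ℂ →L[ℝ] EuclideanSpace ℝ (Fin 4)) = PhiD 0 :=
    ⟨ContinuousLinearEquiv.ofBijective (PhiD 0) (LinearMap.ker_eq_bot.mpr hAinj)
      (LinearMap.range_eq_top.mpr hAsurj), ContinuousLinearEquiv.coe_ofBijective _ _ _⟩
  -- Step 6: inverse function theorem at `(0, 0)` and restriction to the open set `S'` where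
  -- `‖z‖ < r` and the differential of `Φfun` is invertible.
  have hU0 : ((0 : ℂ), (0 : ℂ)) ∈ U := h0r
  have hcd0 : ContDiffAt ℝ ∞ Φfun (0, 0) := hΦU.contDiffAt (hUo.mem_nhds hU0)
  have hstrict :
      HasStrictFDerivAt Φfun (Aeq : ℂ × ℂ →L[ℝ] EuclideanSpace ℝ (Fin 4)) (0, 0) := by
    rw [hAeq]
    exact hcd0.hasStrictFDerivAt' hd0 (by simp)
  set S' : Set (ℂ × ℂ) := U ∩ fderiv ℝ Φfun ⁻¹'
    Set.range ((↑) : ((ℂ × ℂ) ≃L[ℝ] EuclideanSpace ℝ (Fin 4)) →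
      (ℂ × ℂ →L[ℝ] EuclideanSpace ℝ (Fin 4)))
  have hS'o : IsOpen S' :=
    (hΦU.continuousOn_fderiv_of_isOpen hUo (by simp)).isOpen_inter_preimage hUo
      ContinuousLinearEquiv.isOpen
  have h0S' : ((0 : ℂ), (0 : ℂ)) ∈ S' := ⟨hU0, Aeq, by rw [hAeq, hd0.fderiv]⟩
  obtain ⟨Φ, hΦcoe, hΦ0, hΦS'⟩ :
      ∃ Φ : OpenPartialHomeomorph (ℂ × ℂ) (EuclideanSpace ℝ (Fin 4)),
        (Φ : ℂ × ℂ → EuclideanSpace ℝ (Fin 4)) = Φfun ∧ ((0 : ℂ), (0 : ℂ)) ∈ Φ.source ∧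
          Φ.source ⊆ S' :=
    ⟨(hstrict.toOpenPartialHomeomorph Φfun).restrOpen S' hS'o, rfl,
      ⟨hstrict.mem_toOpenPartialHomeomorph_source, h0S'⟩, Set.inter_subset_right⟩
  -- Step 7: a bidisc inside the source, and the conclusions.
  obtain ⟨ε, hε, hball⟩ := Metric.mem_nhds_iff.mp (Φ.open_source.mem_nhds hΦ0)
  have hfd : ∀ z ∈ Metric.ball (0 : ℂ) r, fderiv ℝ Φ (z, 0) = PhiD z := fun z hz => by
    rw [hΦcoe]
    exact (hderiv z hz).fderiv
  refine ⟨Φ, min ε r, lt_min hε hr, min_le_right _ _, ?_, ?_, ?_, ?_, ?_, ?_⟩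
  · intro q h1 h2
    refine hball ?_
    rw [Metric.mem_ball, Prod.dist_eq]
    change max (dist q.1 0) (dist q.2 0) < ε
    rw [dist_zero_right, dist_zero_right]
    exact max_lt (h1.trans_le (min_le_left _ _)) (h2.trans_le (min_le_left _ _))
  · intro z _
    rw [hΦcoe, hΦfun_def]
    simp
  · rw [hΦcoe]
    exact hΦU.mono fun q hq => (hΦS' hq).1
  · intro a ha
    have hq : Φ.symm a ∈ Φ.source := Φ.map_target ha
    obtain ⟨hqU, e, he⟩ := hΦS' hq
    have he' : (e : ℂ × ℂ →L[ℝ] EuclideanSpace ℝ (Fin 4)) = fderiv ℝ Φfun (Φ.symm a) := he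
    have hqcd : ContDiffAt ℝ ∞ Φfun (Φ.symm a) := hΦU.contDiffAt (hUo.mem_nhds hqU)
    have hd : HasFDerivAt Φ (e : ℂ × ℂ →L[ℝ] EuclideanSpace ℝ (Fin 4)) (Φ.symm a) := by
      rw [hΦcoe, he']
      exact (hqcd.differentiableAt (by simp)).hasFDerivAt
    exact (Φ.contDiffAt_symm ha hd (by rw [hΦcoe]; exact hqcd)).contDiffWithinAt
  · intro q hq
    obtain ⟨-, e, he⟩ := hΦS' hq
    have he' : (e : ℂ × ℂ →L[ℝ] EuclideanSpace ℝ (Fin 4)) = fderiv ℝ Φfun q := he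
    rw [hΦcoe, ← he']
    exact e.bijective
  · intro z hz w
    have hz' : z ∈ Metric.ball (0 : ℂ) r :=
      mem_ball_zero_iff.mpr (hz.trans_le (min_le_right _ _))
    rw [hfd z hz']
    exact hJad z hz' w

end Summit.SmoothPoincare4.SmoothPoincare4.Theorems.WitnessCharge.PencilIncompleteness
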